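import Summits.HubbardSuperconductivity.HubbardLadder.Bounds.ComplexFugacityOffArc
import Literature.Probability.LatticeModels.PolymerLogZLipschitz
import Literature.Probability.LatticeModels.PSStability
import HarnessLib

/-!
# Analyticity of the complex-fugacity activities and of their Kotecký–Preiss logarithm
# (bounds.tex Lemma 13.4, model part I)

HONEST FRAMING (cell pub-hubbard): ladder R1–R4 with certified numbers; no claim on H/H₀. Bounds
for model classes (the seam-twisted translation-invariant `t–t'` Hubbard torus), no materials
claim. Imports part F4 (`ComplexFugacityOffArc`, LEAN FILING REQUEST #211.5; through it parts F2,
F3, S) and the Literature files `PolymerLogZLipschitz` (Lipschitz bound and, through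
`PolymerPressureAnalytic`, parameter analyticity of the Kotecký–Preiss logarithm) and `PSStability`
(`log Ξ(0) = 0`).

Part F8e of the kernel device for bounds.tex Theorem 13 (N-sector form): the inputs of the
VARIANCE bound (Lemma 13.4) that concern the polymer gas at COMPLEX chemical potential `μ`:
* `μ ↦ Zc(β,U,μ;c)`, `μ ↦ g(c) = Zc(c)/Zc(0)`, `μ ↦ ρ^{μ}_θ(A) = siteActivityC … μ … A` are
  complex-differentiable wherever `z₀(β,U,μ) ≠ 0` (`differentiable_Zc_mu`,
  `differentiableAt_gibbsRatio_mu`, `differentiableAt_siteActivityC_mu`,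
  `differentiableAt_ttActivityMu`);
* zero-freeness of `Ξ(u ρ^{μ}_θ)` along the rays `u ∈ [0,1]` under the one-site smallness of part
  F3 (`polymerPartitionFunction_ray_ttActivityMu_ne_zero`), hence complex-differentiability of
  `ζ ↦ log Ξ(ρ^{ζ/β}_θ)` on any open set where `z₀ ≠ 0` and the smallness holds
  (`differentiableOn_polymerLogZ_ttActivityMu`);
* the free-energy bound `‖log Ξ(ρ^{μ}_θ)‖ ≤ a |Λ_L|` (`norm_polymerLogZ_ttActivityMu_le`).

References: bounds.tex §13 (Lemma 13.4); R. Kotecký, D. Preiss, Comm. Math. Phys. 103 (1986) 491,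
Theorem p. 492 and p. 493 [KoteckyPreiss1986]; D. Ueltschi, J. Stat. Phys. 95 (1999) 693, §2.3
[Ueltschi1999].
-/

noncomputable section

namespace Summit.HubbardSuperconductivity.HubbardLadder.Bounds

open Finset Complex Metric
open Literature.MathematicalPhysics.QuantumLattice
open Literature.Probability.LatticeModels
open scoped Matrix.Norms.L2Operator

/-! ### Analyticity in the chemical potential -/

section General

variable {Λ : Type*} [LinearOrder Λ] [Fintype Λ]

/-- **The generalised Gibbs factor is entire in `μ`**: `μ ↦ Zc(β,U,μ;c) = Tr exp(-βV_Λ(μ) + Σ c T)`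
is complex-differentiable (the exponent is affine in `μ`). [folklore; Ueltschi1999 §2.3] -/
theorem differentiable_Zc_mu (β U : ℂ) (c : Bond Λ → ℂ) :
    Differentiable ℂ (fun μ : ℂ => Zc β U μ c) := by
  unfold Zc
  have hX : Differentiable ℂ (fun μ : ℂ => onSiteSum U μ (Finset.univ : Finset Λ)) := by
    have : ∀ μ : ℂ, onSiteSum U μ (Finset.univ : Finset Λ) =
        (∑ x : Λ, U • (numberOp x 0 * numberOp x 1)) -
          μ • ∑ x : Λ, (numberOp x 0 + numberOp x 1) := by
      intro μ; simp only [onSiteSum, onSiteOp, Finset.sum_sub_distrib, Finset.smul_sum]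
    simp_rw [this]
    exact (differentiable_const _).sub (differentiable_id.smul_const _)
  have haff : Differentiable ℂ
      (fun μ : ℂ => -(β • onSiteSum U μ (Finset.univ : Finset Λ)) + hopSum c) :=
    (hX.const_smul β).neg.add (differentiable_const _)
  have hexp : Differentiable ℂ
      (fun X : Matrix (Finset (Orb Λ)) (Finset (Orb Λ)) ℂ => NormedSpace.exp X) :=
    fun X => (NormedSpace.exp_analytic (𝕂 := ℂ) X).differentiableAt
  have htr : Differentiable ℂ (fun X : Matrix (Finset (Orb Λ)) (Finset (Orb Λ)) ℂ => X.trace) :=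
    (Matrix.traceLinearMap (Finset (Orb Λ)) ℂ ℂ).toContinuousLinearMap.differentiable
  exact htr.comp (hexp.comp haff)

/-- **The normalised Gibbs factor is analytic in `μ`** off the zeros of `z₀`:
`μ ↦ g(c) = Zc(c)/Zc(0)` is differentiable at `μ` if `z₀(β,U,μ) ≠ 0`.
[folklore; Ueltschi1999 §2.3] -/
theorem differentiableAt_gibbsRatio_mu (β U : ℂ) {μ : ℂ} (hz : atomicPartitionFn β U μ ≠ 0)
    (c : Bond Λ → ℂ) : DifferentiableAt ℂ (fun μ : ℂ => gibbsRatio β U μ c) μ := by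
  unfold gibbsRatio
  exact ((differentiable_Zc_mu β U c) μ).div ((differentiable_Zc_mu β U 0) μ)
    (Zc_zero_ne_zero hz)

/-- **The site activities are analytic in `μ`** off the zeros of `z₀` (finite signed sums of
normalised Gibbs factors). [folklore; Ueltschi1999 §2.3] -/
theorem differentiableAt_siteActivityC_mu (P : Finset (Bond Λ)) (β U : ℂ) {μ : ℂ}
    (hz : atomicPartitionFn β U μ ≠ 0) (c : Bond Λ → ℂ) (A : Finset Λ) :
    DifferentiableAt ℂ (fun μ : ℂ => siteActivityC P β U μ c A) μ := by
  simp only [siteActivityC_apply, bondWeightC]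
  refine DifferentiableAt.fun_sum fun X _ => DifferentiableAt.fun_sum fun K' _ => ?_
  exact (differentiableAt_gibbsRatio_mu β U hz _).const_mul _

end General

/-! ### The twisted torus at complex fugacity -/

section Torus

variable {L : ℕ} [NeZero L]

/-- The complex-fugacity activities of the twisted torus are analytic in `μ` off the zeros of
`z₀`. [this file] -/
theorem differentiableAt_ttActivityMu (β t' U : ℝ) {μ : ℂ}
    (hz : atomicPartitionFn (β : ℂ) (U : ℂ) μ ≠ 0) (θ : ℝ) (A : Finset (FermionTorus 2 L)) :
    DifferentiableAt ℂ (fun μ : ℂ => ttActivityMu L β t' U μ θ A) μ := by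
  unfold ttActivityMu
  exact differentiableAt_siteActivityC_mu _ _ _ hz _ A

/-- The same in the variable `ζ = βμ`: `ζ ↦ ρ^{ζ/β}_θ(A)` is differentiable at `ζ` if
`z₀(β,U,ζ/β) ≠ 0`. [this file] -/
theorem differentiableAt_ttActivityMu_div (β t' U : ℝ) {ζ : ℂ}
    (hz : atomicPartitionFn (β : ℂ) (U : ℂ) (ζ / β) ≠ 0) (θ : ℝ) (A : Finset (FermionTorus 2 L)) :
    DifferentiableAt ℂ (fun ζ : ℂ => ttActivityMu L β t' U (ζ / β) θ A) ζ := by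
  have h1 : DifferentiableAt ℂ (fun μ : ℂ => ttActivityMu L β t' U μ θ A) (ζ / β) :=
    differentiableAt_ttActivityMu β t' U hz θ A
  have h2 : DifferentiableAt ℂ (fun ζ : ℂ => ζ / (β : ℂ)) ζ := differentiableAt_id.div_const _
  have h := h1.comp ζ h2
  exact h

/-- **Zero-freeness along the rays at complex fugacity**: under the one-site smallness of part F3,
`Ξ(u ρ^{μ}_θ) ≠ 0` for `u ∈ [0,1]`. [this file; KoteckyPreiss1986 Theorem p. 492] -/
theorem polymerPartitionFunction_ray_ttActivityMu_ne_zero (hL : 3 ≤ L) (β t' U : ℝ) {μ : ℂ}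
    (θ : ℝ) (hz : atomicPartitionFn (β : ℂ) (U : ℂ) μ ≠ 0) {a δ : ℝ} (ha : 0 < a) (hδ : 0 < δ)
    (hsmall : 16 * (|β| * (1 + |t'|)) * Real.exp (2 * (|β| * (1 + |t'|))) *
      (siteRatio (β : ℂ) (U : ℂ) μ * Real.exp (a + δ) + a) ^ 2 ≤ a)
    {u : ℝ} (hu : u ∈ Set.Icc (0 : ℝ) 1) :
    polymerPartitionFunction polyInc (fun A => (u : ℂ) * ttActivityMu L β t' U μ θ A)
      (Finset.univ : Finset (FermionTorus 2 L)).powerset ≠ 0 := by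
  have hKP := (isSmallActivityA_ttActivityMu hL β t' U θ hz ha hδ hsmall).isKPVolume
    (Finset.univ : Finset (FermionTorus 2 L)).powerset
  have hKPu : IsKPVolume polyInc (fun A => (u : ℂ) * ttActivityMu L β t' U μ θ A)
      (fun A : Finset (FermionTorus 2 L) => a * (A.card : ℝ))
      (Finset.univ : Finset (FermionTorus 2 L)).powerset := fun γ hγ => by
    refine le_trans (Finset.sum_le_sum fun γ' _ => ?_) (hKP γ hγ)
    unfold kpTerm
    refine mul_le_mul_of_nonneg_right ?_ (Real.exp_nonneg _)
    rw [norm_mul, Complex.norm_real, Real.norm_eq_abs, abs_of_nonneg hu.1]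
    exact mul_le_of_le_one_left (norm_nonneg _) hu.2
  exact polymerPartitionFunction_ne_zero_of_kp hKPu Finset.Subset.rfl

/-- **Holomorphy of the Kotecký–Preiss logarithm in the complex fugacity**: on an open set `V` of
`ζ = βμ` where `z₀(β,U,ζ/β) ≠ 0` and the one-site smallness of part F3 holds,
`ζ ↦ log Ξ(ρ^{ζ/β}_θ)` is complex-differentiable. [this file; KoteckyPreiss1986 p. 493,
Ueltschi1999 §2.3] -/
theorem differentiableOn_polymerLogZ_ttActivityMu (hL : 3 ≤ L) (β t' U θ : ℝ) {V : Set ℂ}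
    (hV : IsOpen V) (hz : ∀ ζ ∈ V, atomicPartitionFn (β : ℂ) (U : ℂ) (ζ / β) ≠ 0) {a δ : ℝ}
    (ha : 0 < a) (hδ : 0 < δ)
    (hsmall : ∀ ζ ∈ V, 16 * (|β| * (1 + |t'|)) * Real.exp (2 * (|β| * (1 + |t'|))) *
      (siteRatio (β : ℂ) (U : ℂ) (ζ / β) * Real.exp (a + δ) + a) ^ 2 ≤ a) :
    DifferentiableOn ℂ (fun ζ : ℂ => polymerLogZ polyInc (ttActivityMu L β t' U (ζ / β) θ)
      (Finset.univ : Finset (FermionTorus 2 L)).powerset) V :=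
  differentiableOn_polymerLogZ_param (Finset.univ : Finset (FermionTorus 2 L)).powerset hV
    (fun A _ ζ hζ =>
      (differentiableAt_ttActivityMu_div β t' U (hz ζ hζ) θ A).differentiableWithinAt)
    fun ζ hζ _ hu => polymerPartitionFunction_ray_ttActivityMu_ne_zero hL β t' U θ (hz ζ hζ) ha hδ
      (hsmall ζ hζ) hu

/-- **The free-energy bound at complex fugacity**: `‖log Ξ(ρ^{μ}_θ)‖ ≤ a |Λ_L|` under the one-site
smallness of part F3 (Lipschitz bound of the Kotecký–Preiss logarithm against the zero activity,
then the anchored one-site sums). [this file; KoteckyPreiss1986 Theorem p. 492] -/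
theorem norm_polymerLogZ_ttActivityMu_le (hL : 3 ≤ L) (β t' U : ℝ) {μ : ℂ} (θ : ℝ)
    (hz : atomicPartitionFn (β : ℂ) (U : ℂ) μ ≠ 0) {a δ : ℝ} (ha : 0 < a) (hδ : 0 < δ)
    (hsmall : 16 * (|β| * (1 + |t'|)) * Real.exp (2 * (|β| * (1 + |t'|))) *
      (siteRatio (β : ℂ) (U : ℂ) μ * Real.exp (a + δ) + a) ^ 2 ≤ a) :
    ‖polymerLogZ polyInc (ttActivityMu L β t' U μ θ)
        (Finset.univ : Finset (FermionTorus 2 L)).powerset‖ ≤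
      a * Fintype.card (FermionTorus 2 L) := by
  have hS : IsSmallActivityA (ttActivityMu L β t' U μ θ) a δ :=
    isSmallActivityA_ttActivityMu hL β t' U θ hz ha hδ hsmall
  have hA := hS.isKPVolume (Finset.univ : Finset (FermionTorus 2 L)).powerset
  have hB : IsKPVolume polyInc (0 : Finset (FermionTorus 2 L) → ℂ)
      (fun A : Finset (FermionTorus 2 L) => a * (A.card : ℝ))
      (Finset.univ : Finset (FermionTorus 2 L)).powerset := by
    intro γ _
    rw [Finset.sum_eq_zero fun γ' _ => by simp [kpTerm]]
    exact mul_nonneg ha.le (Nat.cast_nonneg _)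
  have h := norm_polymerLogZ_sub_polymerLogZ_le hA hB
  rw [ContourModel.polymerLogZ_zero, sub_zero] at h
  refine h.trans ?_
  simp only [Pi.zero_apply, sub_zero]
  have hg0 : ∀ A : Finset (FermionTorus 2 L),
      0 ≤ ‖ttActivityMu L β t' U μ θ A‖ * Real.exp (a * (A.card : ℝ)) := fun A => by positivity
  have hge : ‖ttActivityMu L β t' U μ θ ∅‖ *
      Real.exp (a * ((∅ : Finset (FermionTorus 2 L)).card : ℝ)) = 0 := by
    rw [hS.rho_empty, norm_zero, zero_mul]
  refine (sum_powerset_le_sum_sum_filter_mem hg0 hge).trans ?_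
  calc ∑ x : FermionTorus 2 L, ∑ A ∈ (Finset.univ : Finset (FermionTorus 2 L)).powerset.filter
          (fun A => x ∈ A), ‖ttActivityMu L β t' U μ θ A‖ * Real.exp (a * (A.card : ℝ))
      ≤ ∑ _x : FermionTorus 2 L, a := by
        refine Finset.sum_le_sum fun x _ => ?_
        refine le_trans (Finset.sum_le_sum fun A _ => ?_)
          (hS.sum_le x _ fun A hA => (Finset.mem_filter.1 hA).2)
        refine mul_le_mul_of_nonneg_left (Real.exp_le_exp.2 ?_) (norm_nonneg _)
        exact mul_le_mul_of_nonneg_right (le_add_of_nonneg_right hδ.le) (Nat.cast_nonneg _)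
    _ = a * Fintype.card (FermionTorus 2 L) := by
        rw [Finset.sum_const, Finset.card_univ, nsmul_eq_mul, mul_comm]

end Torus

end Summit.HubbardSuperconductivity.HubbardLadder.Bounds

end
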